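import Literature.NumberTheory.EllipticCurves.ShaRestriction
import Mathlib.NumberTheory.NumberField.Completion.FinitePlace
import Mathlib.RingTheory.Ideal.Pointwise
import Mathlib.Topology.Algebra.Valued.ValuationTopology
import HarnessLib

/-!
# T-res (second half), file A: Galois conjugation on the completions of a number field at finite
# places, and `L_w = K_v · L` (cell `b2b-bsdres`, n1011, p17 GEN 4; r2 ROUTE-2 §II.17.7 T-res)

HONEST FRAMING (cell `b2b-bsdres`, verbatim in every file): prove what is provable now; nothing is
booked; no label changes. Infrastructure (Galois theory of completions of number fields); ONE
definition (the completed conjugation map) + THEOREMS; NO Literature fact; no `sorry`.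

For a finite extension of number fields `L/K`, a `K`-automorphism `g` of `L` and finite places
`w, w'` of `L` with `g • 𝔭_w = 𝔭_{w'}` (pointwise action of `Gal(L/K)` on the ideals of `𝓞 L`,
Mathlib `Ideal.pointwiseMulSemiringAction`):

* `valuation_smul_eq` : `w'(g x) = w(x)` on `L` (`g` permutes the prime factorisations);
* `adicCompletionConj g w w' h : L_w →+* L_{w'}` : the continuous extension of `g` to the
  completions (`WithVal.congr` preserves `Valued.v`, hence is uniformly continuous;
  `UniformSpace.Completion.mapRingHom`), with `adicCompletionConj_coe` (`= g` on `L`),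
  `continuous_adicCompletionConj`, and `adicCompletionConj_comp_adicCompletionMap`: it commutes
  with the maps `K_v → L_w`, `K_v → L_{w'}` of the tree's `ShaRestriction` (density of `K`);
* `closure_range_adicCompletionMap_union_eq_top` : `L_w` is generated, as a ring, by the images of
  `K_v` and `L` (the dense-range/closed-range argument behind Mathlib's instance
  `Module.Finite K_v L_w`, `NumberField.Completion.FinitePlace`, run to the surjectivity of
  `K_v ⊗[K] L → L_w`).

These feed file B (every `K`-embedding `L → Ω` into an algebraically closed `K_v`-field factors
through some `L_w`, `w ∣ v`) and the transport of the local Selmer conditions along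
`ZpTower.kerH1Iso` (p01's `Additive/ZpTowerKernelH1.lean`).

References: [SerreLocalFields1979] II.§3 (completions and extensions); [NeukirchANT1999] II.§8
(extensions of valuations, `L ⊗_K K_v = ∏ L_w`).
-/

noncomputable section

open scoped Classical Pointwise TensorProduct

open NumberField IsDedekindDomain Literature.NumberTheory.EllipticCurves

universe u

namespace Summit.BirchSwinnertonDyer.Rank1Residual.Additive.LocalTransport

variable {K : Type u} [Field K] {L : Type u} [Field L] [NumberField L] [Algebra K L]

/-! ## The action of `Gal(L/K)` on finite places and valuations -/

section Valuation

variable (g : L ≃ₐ[K] L) (w w' : HeightOneSpectrum (𝓞 L))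

omit [NumberField L] in
/-- The coercion `𝓞 L → L` commutes with the action of `Gal(L/K)`. [folklore] -/
@[simp]
theorem coe_smul_ringOfIntegers (x : 𝓞 L) : ((g • x : 𝓞 L) : L) = g (x : L) :=
  rfl

omit [NumberField L] in
/-- `g • 𝔭 ≠ ⊥` for a nonzero prime `𝔭` of `𝓞 L`. [folklore] -/
theorem smul_asIdeal_ne_bot : g • w.asIdeal ≠ ⊥ := by
  intro h
  apply w.ne_bot
  have := congrArg (fun I : Ideal (𝓞 L) ↦ g⁻¹ • I) h
  simpa only [inv_smul_smul, Ideal.smul_bot] using this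

/-- The finite place `g • w` of `L`: the prime `g • 𝔭_w` (prime by Mathlib's `Ideal.IsPrime.smul`).
[folklore] -/
def smulPlace : HeightOneSpectrum (𝓞 L) where
  asIdeal := g • w.asIdeal
  isPrime := inferInstance
  ne_bot := smul_asIdeal_ne_bot g w

omit [NumberField L] in
/-- The prime of `g • w` is `g • 𝔭_w`. [folklore] -/
@[simp]
theorem smulPlace_asIdeal : (smulPlace g w).asIdeal = g • w.asIdeal :=
  rfl

omit [NumberField L] in
/-- `g⁻¹ • (g • w) = w` at the level of primes. [folklore] -/
theorem smul_smulPlace_inv_asIdeal : g • (smulPlace g⁻¹ w).asIdeal = w.asIdeal := by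
  rw [smulPlace_asIdeal, smul_inv_smul]

variable {g w w'}

/-- **`g` transports `w`-adic valuations to `w'`-adic valuations on `𝓞 L`** when
`g • 𝔭_w = 𝔭_{w'}`: the multiplicity of `𝔭_{w'}` in `(g x)` is the multiplicity of `𝔭_w` in
`(x)`, `g` acting on the monoid of ideals by a multiplicative equivalence
(`MulDistribMulAction.toMulEquiv`, `multiplicity_map_eq`). [cite: NeukirchANT1999, II.§8] -/
theorem intValuation_smul_eq (h : g • w.asIdeal = w'.asIdeal) (x : 𝓞 L) :
    w'.intValuation (g • x) = w.intValuation x := by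
  rcases eq_or_ne x 0 with rfl | hx
  · simp
  have hgx : g • x ≠ 0 := fun h0 ↦ hx (by simpa using congrArg (fun y ↦ g⁻¹ • y) h0)
  rw [HeightOneSpectrum.intValuation_eq_exp_neg_multiplicity w hx,
    HeightOneSpectrum.intValuation_eq_exp_neg_multiplicity w' hgx]
  congr 3
  have hspan : (Ideal.span {g • x} : Ideal (𝓞 L)) = g • Ideal.span {x} := by
    rw [Ideal.smul_closure, Set.smul_set_singleton]
  rw [hspan, ← h]
  exact multiplicity_map_eq (MulDistribMulAction.toMulEquiv (Ideal (𝓞 L)) g)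

/-- **`w'(g x) = w(x)` on `L`** when `g • 𝔭_w = 𝔭_{w'}`. [cite: NeukirchANT1999, II.§8] -/
theorem valuation_smul_eq (h : g • w.asIdeal = w'.asIdeal) (x : L) :
    w'.valuation L (g x) = w.valuation L x := by
  obtain ⟨a, b, hb, rfl⟩ := IsFractionRing.div_surjective (A := 𝓞 L) x
  rw [map_div₀, map_div₀, map_div₀]
  have ha : g (algebraMap (𝓞 L) L a) = algebraMap (𝓞 L) L (g • a) := rfl
  have hb' : g (algebraMap (𝓞 L) L b) = algebraMap (𝓞 L) L (g • b) := rfl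
  rw [ha, hb', HeightOneSpectrum.valuation_of_algebraMap, HeightOneSpectrum.valuation_of_algebraMap,
    HeightOneSpectrum.valuation_of_algebraMap, HeightOneSpectrum.valuation_of_algebraMap,
    intValuation_smul_eq h, intValuation_smul_eq h]

/-- `g` maps primes over `v` to primes over `v` (`Ideal.under_smul`; the `𝓞 K`-action and the
Galois action on `𝓞 L` commute, `IsGaloisGroup.of_isFractionRing`). [folklore] -/
theorem liesOver_of_smul_eq [NumberField K] [IsGalois K L] (v : HeightOneSpectrum (𝓞 K))
    (h : g • w.asIdeal = w'.asIdeal) [hw : w.asIdeal.LiesOver v.asIdeal] :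
    w'.asIdeal.LiesOver v.asIdeal := by
  haveI : IsGaloisGroup (L ≃ₐ[K] L) (𝓞 K) (𝓞 L) := IsGaloisGroup.of_isFractionRing _ _ _ K L
  refine ⟨?_⟩
  rw [← h, Ideal.under_smul]
  exact hw.over

end Valuation

/-! ## The completed conjugation `L_w → L_{w'}` -/

section Conj

variable (g : L ≃ₐ[K] L) (w w' : HeightOneSpectrum (𝓞 L)) (h : g • w.asIdeal = w'.asIdeal)

/-- `g` as a ring isomorphism `WithVal w → WithVal w'` of the valued copies of `L`
(Mathlib `WithVal.congr`). [folklore] -/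
def conjWithVal : WithVal (w.valuation L) ≃+* WithVal (w'.valuation L) :=
  WithVal.congr (w.valuation L) (w'.valuation L) (g : L ≃+* L)

/-- Unfolding `conjWithVal`. [folklore] -/
@[simp]
theorem conjWithVal_apply (x : WithVal (w.valuation L)) :
    conjWithVal g w w' x = WithVal.toVal (w'.valuation L) (g x.ofVal) :=
  rfl

include h in
/-- `conjWithVal` preserves the valuations: `v_{w'}(g x) = v_w(x)`. [cite: NeukirchANT1999, II.§8] -/
theorem valued_conjWithVal (x : WithVal (w.valuation L)) :
    Valued.v (conjWithVal g w w' x) = Valued.v x := by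
  rw [conjWithVal_apply, WithVal.valued_toVal, ← WithVal.apply_ofVal]
  exact valuation_smul_eq h x.ofVal

include h in
/-- A valuation-preserving ring isomorphism of valued fields is uniformly continuous
(`Valued.hasBasis_uniformity`). [folklore] -/
theorem uniformContinuous_conjWithVal : UniformContinuous (conjWithVal g w w') := by
  rw [((Valued.hasBasis_uniformity (WithVal (w.valuation L))
      (WithZero (Multiplicative ℤ))).uniformContinuous_iff
    (Valued.hasBasis_uniformity (WithVal (w'.valuation L)) (WithZero (Multiplicative ℤ))))]
  intro γ' _
  obtain ⟨r', s', hr', hs', hγ'⟩ := Valuation.exists_div_eq_of_unit Valued.v γ'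
  have hr : 0 < Valued.v ((conjWithVal g w w').symm r') := by
    rwa [← valued_conjWithVal g w w' h, RingEquiv.apply_symm_apply]
  have hs : 0 < Valued.v ((conjWithVal g w w').symm s') := by
    rwa [← valued_conjWithVal g w w' h, RingEquiv.apply_symm_apply]
  have hr0 : Valued.v.restrict ((conjWithVal g w w').symm r') ≠ 0 := fun h0 ↦
    hr.ne' ((Valuation.restrict_eq_zero_iff _).mp h0)
  have hs0 : Valued.v.restrict ((conjWithVal g w w').symm s') ≠ 0 := fun h0 ↦
    hs.ne' ((Valuation.restrict_eq_zero_iff _).mp h0)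
  refine ⟨Units.mk0 _ (div_ne_zero hr0 hs0), trivial, fun x y hxy ↦ ?_⟩
  simp only [Set.mem_setOf_eq, Units.val_mk0] at hxy ⊢
  rw [lt_div_iff₀ (zero_lt_iff.mpr hs0), ← map_mul, Valuation.restrict_lt_iff,
    ← valued_conjWithVal g w w' h ((y - x) * (conjWithVal g w w').symm s'),
    ← valued_conjWithVal g w w' h ((conjWithVal g w w').symm r'), map_mul,
    RingEquiv.apply_symm_apply, RingEquiv.apply_symm_apply] at hxy
  rw [← hγ', lt_div_iff₀ ((Valuation.restrict_pos_iff _ _).mpr hs'), ← map_mul,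
    Valuation.restrict_lt_iff, ← map_sub]
  exact hxy

/-- **The completed conjugation `ĝ : L_w →+* L_{w'}`** extending `g : L → L` when
`g • 𝔭_w = 𝔭_{w'}` (Mathlib `UniformSpace.Completion.mapRingHom` of the uniformly continuous
`conjWithVal`, transported along `adicCompletion.equiv`). [cite: SerreLocalFields1979, II.§3] -/
def adicCompletionConj : w.adicCompletion L →+* w'.adicCompletion L :=
  (HeightOneSpectrum.adicCompletion.equiv L w').symm.toRingHom.comp
    ((UniformSpace.Completion.mapRingHom (conjWithVal g w w').toRingHom
        (uniformContinuous_conjWithVal g w w' h).continuous).comp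
      (HeightOneSpectrum.adicCompletion.equiv L w).toRingHom)

/-- `ĝ` extends `g`: `ĝ (x : L_w) = (g x : L_{w'})`. [cite: SerreLocalFields1979, II.§3] -/
@[simp]
theorem adicCompletionConj_coe (x : L) :
    adicCompletionConj g w w' h (x : w.adicCompletion L) = ((g x : L) : w'.adicCompletion L) := by
  apply HeightOneSpectrum.adicCompletion.ext
  simp only [adicCompletionConj, RingHom.coe_comp, RingEquiv.toRingHom_eq_coe, RingHom.coe_coe,
    Function.comp_apply, HeightOneSpectrum.adicCompletion.equiv_apply]
  change (HeightOneSpectrum.adicCompletion.ofCompletion _).toCompletion = _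
  rw [HeightOneSpectrum.adicCompletion.toCompletion_ofCompletion]
  change UniformSpace.Completion.mapRingHom _ _
    ((WithVal.toVal (w.valuation L) x : WithVal (w.valuation L)) : (w.valuation L).Completion) =
    ((WithVal.toVal (w'.valuation L) (g x) : WithVal (w'.valuation L)) :
      (w'.valuation L).Completion)
  rw [UniformSpace.Completion.mapRingHom_coe]
  rfl

/-- `ĝ` is continuous. [cite: SerreLocalFields1979, II.§3] -/
theorem continuous_adicCompletionConj : Continuous (adicCompletionConj g w w' h) := by
  unfold adicCompletionConj
  exact (HeightOneSpectrum.adicCompletion.continuous_ofCompletion L w').comp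
    (UniformSpace.Completion.continuous_map.comp
      (HeightOneSpectrum.adicCompletion.continuous_toCompletion L w))

/-- The map `K_v → L_w` of the tree's `ShaRestriction` (`adicCompletionMap`) is continuous.
[folklore] -/
theorem continuous_adicCompletionMap [NumberField K] (v : HeightOneSpectrum (𝓞 K))
    [w.asIdeal.LiesOver v.asIdeal] :
    Continuous (adicCompletionMap (K := K) L v w) := by
  unfold adicCompletionMap
  exact (HeightOneSpectrum.adicCompletion.continuous_ofCompletion L w).comp
    (UniformSpace.Completion.continuous_map.comp
      (HeightOneSpectrum.adicCompletion.continuous_toCompletion K v))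

/-- **`ĝ` commutes with `K_v → L_w`, `K_v → L_{w'}`**: two continuous ring homomorphisms out of
`K_v` that agree on the dense image of `K` (`g` fixes `K`). [cite: SerreLocalFields1979, II.§3] -/
theorem adicCompletionConj_comp_adicCompletionMap [NumberField K] (v : HeightOneSpectrum (𝓞 K))
    [w.asIdeal.LiesOver v.asIdeal] [w'.asIdeal.LiesOver v.asIdeal] :
    (adicCompletionConj g w w' h).comp (adicCompletionMap (K := K) L v w) =
      adicCompletionMap (K := K) L v w' := by
  have hcoe : ∀ x : K, adicCompletionMap (K := K) L v w (algebraMap K (v.adicCompletion K) x) =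
      algebraMap L (w.adicCompletion L) (algebraMap K L x) := fun x ↦
    adicCompletionMap_coe (K := K) L v w x
  have hcoe' : ∀ x : K, adicCompletionMap (K := K) L v w' (algebraMap K (v.adicCompletion K) x) =
      algebraMap L (w'.adicCompletion L) (algebraMap K L x) := fun x ↦
    adicCompletionMap_coe (K := K) L v w' x
  have hg : ∀ x : L, adicCompletionConj g w w' h (algebraMap L (w.adicCompletion L) x) =
      algebraMap L (w'.adicCompletion L) (g x) := fun x ↦ adicCompletionConj_coe g w w' h x
  have key : (adicCompletionConj g w w' h ∘ adicCompletionMap (K := K) L v w :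
      v.adicCompletion K → w'.adicCompletion L) = adicCompletionMap (K := K) L v w' := by
    refine (HeightOneSpectrum.denseRange_algebraMap (K := K) v).equalizer
      ((continuous_adicCompletionConj g w w' h).comp (continuous_adicCompletionMap w v))
      (continuous_adicCompletionMap w' v) ?_
    funext x
    simp only [Function.comp_apply]
    rw [hcoe, hcoe', hg, AlgEquiv.commutes]
  exact DFunLike.ext' key

end Conj

/-! ## `L_w` is generated by `K_v` and `L` -/

section Generation

variable [NumberField K] (L) (v : HeightOneSpectrum (𝓞 K)) (w : HeightOneSpectrum (𝓞 L))
  [w.asIdeal.LiesOver v.asIdeal]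

open scoped Valued in
/-- **`L_w = K_v[L]`**: every element of `L_w` lies in the subring generated by the images of
`K_v → L_w` and `L → L_w`. With the `K_v`-algebra structure given by `K_v → L_w`, the
multiplication map `K_v ⊗[K] L → L_w` has finite-dimensional (hence closed) and dense (it contains
`L`) range, so it is onto (the argument of Mathlib's instance `Module.Finite K_v L_w`).
[cite: NeukirchANT1999, II.§8] -/
theorem closure_range_adicCompletionMap_union_eq_top :
    Subring.closure (Set.range (adicCompletionMap (K := K) L v w) ∪
      Set.range (algebraMap L (w.adicCompletion L))) = ⊤ := by
  letI : Algebra (v.adicCompletion K) (w.adicCompletion L) :=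
    (adicCompletionMap (K := K) L v w).toAlgebra
  have hcoe : ∀ x : K, adicCompletionMap (K := K) L v w (algebraMap K (v.adicCompletion K) x) =
      algebraMap L (w.adicCompletion L) (algebraMap K L x) := fun x ↦
    adicCompletionMap_coe (K := K) L v w x
  haveI : IsScalarTower K (v.adicCompletion K) (w.adicCompletion L) :=
    IsScalarTower.of_algebraMap_eq fun x ↦ by
      rw [RingHom.algebraMap_toAlgebra, hcoe, ← IsScalarTower.algebraMap_apply]
  haveI : ContinuousSMul (v.adicCompletion K) (w.adicCompletion L) :=
    ⟨((continuous_adicCompletionMap w v).comp continuous_fst).mul continuous_snd⟩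
  let Φ : (v.adicCompletion K) ⊗[K] L →ₗ[v.adicCompletion K] w.adicCompletion L :=
    (Algebra.TensorProduct.lift (Algebra.algHom _ _ _) (Algebra.algHom K L _)
      (fun _ _ ↦ Commute.all _ _)).toLinearMap
  have h_dense : DenseRange Φ := by
    apply (w.denseRange_algebraMap L).mono
    rintro _ ⟨l, rfl⟩
    exact ⟨1 ⊗ₜ l, by simp [Φ, Algebra.algHom]⟩
  have hsurj : Function.Surjective Φ := by
    rw [← Set.range_eq_univ, ← Φ.coe_range, ← Φ.range.closed_of_finiteDimensional.closure_eq]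
    exact h_dense.closure_range
  rw [eq_top_iff]
  rintro x -
  obtain ⟨t, rfl⟩ := hsurj x
  induction t using TensorProduct.induction_on with
  | zero => rw [map_zero]; exact Subring.zero_mem _
  | tmul a l =>
    have hΦ : Φ (a ⊗ₜ l) = adicCompletionMap (K := K) L v w a * algebraMap L _ l := by
      simp only [Φ, AlgHom.toLinearMap_apply, Algebra.TensorProduct.lift_tmul, Algebra.algHom]
      rfl
    rw [hΦ]
    exact Subring.mul_mem _ (Subring.subset_closure (Or.inl ⟨a, rfl⟩))
      (Subring.subset_closure (Or.inr ⟨l, rfl⟩))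
  | add s t hs ht => rw [map_add]; exact Subring.add_mem _ hs ht

/-- Consequence: two ring homomorphisms `L_w → Ω` that agree on `K_v` and on `L` are equal.
[folklore] -/
theorem ringHom_ext_of_eqOn {Ω : Type*} [Ring Ω] {f f' : w.adicCompletion L →+* Ω}
    (hK : f.comp (adicCompletionMap (K := K) L v w) = f'.comp (adicCompletionMap (K := K) L v w))
    (hL : f.comp (algebraMap L _) = f'.comp (algebraMap L _)) : f = f' := by
  refine RingHom.eq_of_eqOn_set_dense (closure_range_adicCompletionMap_union_eq_top L v w) ?_
  rintro x (⟨a, rfl⟩ | ⟨l, rfl⟩)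
  · exact RingHom.congr_fun hK a
  · exact RingHom.congr_fun hL l

end Generation

end Summit.BirchSwinnertonDyer.Rank1Residual.Additive.LocalTransport

end
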